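/-
Copyright: the b2b-balaban cell (near-miss cell 7), T⁴-continuum fan-out, NE7b ROUND-2 swarm `t4-ne7b-formalise-*`
(seat leaf-07, gen 17), row S6 pt 3b∕3c «zones of realised histories» — the ZONE SKELETON of a realisation and part
II's walk over it (print-exact twin chain R-40-a of the owner's located model finding F-ne7bp1g40-1, ruling
R-OWNER-40-2) of lineage t4-ne7b-p1's claim table `LEAVES-NE7b.md`.  Released under the licence of the surrounding project.
-/
import Summits.QuantumFields.BalabanUV.T4Continuum.Support.HistoryZonesOrbitRealise
import Summits.QuantumFields.BalabanUV.T4Continuum.Support.HistoryRealisePrint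

/-!
# History zones from orbits, V: the zone-side supplier reads NO CLOCK — the zone skeleton of a realisation

Summits-side support leaf of the T⁴-continuum cell (rung (B)+1 on a FINITE torus only; NOT infinite volume, NOT the
mass gap, NOT the Clay statement; NOT a proof of the spine estimate NE7b, which is the cell's OWN estimate, NOT PRINTED
and NOT PROVED).  [folklore] bookkeeping∕finite geometry on the lineage's OWN index model; nothing is quoted from
print, nothing printed is asserted, no `[cite:]` tag, no `Prop` fact minted (`RealisesZ` is a parametrised predicate
between two of OUR carriers: the common weakening of row S1b's `HistoryRealise.Realises` (leaf-08, p209120) and of the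
owner's print-exact `HistoryRealisePrint.RealisesP` (p246311) — both imported, neither modified).

WHY.  The owner's finding F-ne7bp1g40-1 (journal l.26158): row S1b's `Realises` asks the join partners to be pending
THROUGH the join scale (`PendingAt … sj`), one index more than print guarantees; the repair R-40-a is a print-exact twin
chain over `RealisesP` (partners `PendingBefore … sj`).  Parts II–IV of this series (`HistoryZonesOrbitRealise` p212824,
`…Place` p213069, `…Pedigree` p213206) take `Realises` as hypothesis — five theorems DESTRUCTURE it — and sit in the
import cone of the headlines of record, so their print-exact twins are a prerequisite of the END∕headline twins (row
S12-P).  The lineage's site census (journal l.26565, leaf-07 g17) found that at all nine destructuring sites BOTH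
pendency fields and the renewal's first-readiness field are DISCARDED: the zone side reads only the GEOMETRIC SKELETON
of a realisation.  This file types that skeleton once (`RealisesZ`) and re-runs part II's walk over it with the landed
scripts; part VI (`HistoryZonesOrbitRealiseP.lean`) derives parts III–IV and the print-exact twins by one-line bridges —
so that no further re-cut of the pendency clauses (owner's open question Q-ne7bp1g40-1) touches row S6 again.

WHAT.  §0 **`RealisesZ L s P Z`** (birth clause VERBATIM; renewal: an EARLIER last step and the S-image
`orbit … (h+1−lastStep)`; join: partners dated `≤ sj`, touching current images, joined domain inside their union — no
sizes `R`, no `Stops`, no pendency) with the bridges **`realisesZ_of_realises`**, **`realisesZ_of_realisesP`** (structural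
recursion; `Stops.pos` is the only clock fact spent), `lastStep_realisesZ_le`.  §1 part II's facts over `RealisesZ`:
`births_facts_of_corrZ`, `events_step_le_of_corrZ`.  §2 the walk: **`redZone_orbit_subset_regZoneDZ`**, **`contact_of_corrZ`**,
**`birthRegionsD_of_corrZ`** — statements = the landed ones with `Realises L s R P Z ↦ RealisesZ L s P Z`, token for token
otherwise; proofs = the landed scripts with the two idle pattern slots removed.  §3 sanity: row S1b's unit region has
the skeleton through bridge 2; a clock-free realised join.

BY-NAME EFFECT ON THE WALL: NONE (every `WALL-NE7b-P1.md` §2 binder keeps its class; the headline of record stands).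
TYPED BY-PRODUCT: the zone multiplicity of the COUNT reads no clock — pendency and readiness enter the END only
through row S1b's `K < reach` ∕ booking side.

HONEST DEPENDENCY (cell): continuum YM on T⁴ ⇐ BetaPertH ∧ nine spine estimates (0/9 proved); BetaPertH ⇐ (D1) ∧ (D4)
∧ CAP+tail; G-an2-4 gates asym, D1 and NE2/3/4.  This file changes none of it.  NE7b NOT proved.
-/

open Finset
open Literature.MathematicalPhysics.QuantumFieldTheory.Balaban1983to89
open Literature.MathematicalPhysics.QuantumFieldTheory.Balaban1983to89.B13ScaleTransfer
open Literature.MathematicalPhysics.QuantumFieldTheory.Balaban1983to89.TreeLength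
open Literature.MathematicalPhysics.QuantumFieldTheory.Balaban1983to89.B16SProfile
open Literature.MathematicalPhysics.QuantumFieldTheory.Balaban1983to89.B16MergeGeometry
open T4PersistenceDictionary T4PartnerMultiplicity
open Summit.QuantumFields.BalabanUV.T4Continuum.PlacementSkeleton
open Summit.QuantumFields.BalabanUV.T4Continuum.Crowding
open Summit.QuantumFields.BalabanUV.T4Continuum.ZoneSkeleton
open Summit.QuantumFields.BalabanUV.T4Continuum.ZoneCrowd
open Summit.QuantumFields.BalabanUV.T4Continuum.ZoneTorus
open Summit.QuantumFields.BalabanUV.T4Continuum.HistoryAdmissible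
open Summit.QuantumFields.BalabanUV.T4Continuum.HistoryRealise
open Summit.QuantumFields.BalabanUV.T4Continuum.HistoryRealisePrint
open Summit.QuantumFields.BalabanUV.T4Continuum.HistoryRealiseCells

namespace Summit.QuantumFields.BalabanUV.T4Continuum.HistoryZones

noncomputable section

variable {d : ℕ}

/-! ## §0 The zone skeleton of a realisation, and the two bridges -/

/-- **THE ZONE SKELETON OF A REALISED HISTORY** — exactly the clauses of `Realises` ∕ `RealisesP` that the zone side
reads: a NEW REGION (anchor ∈ region, face-connected, class `≥ treeLen`) verbatim; a RENEWAL at `h + 1` of a line with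
an EARLIER last step, the new domain being the `S`-image at `h + 1`; a JOIN at `sj` of two lines dated `≤ sj` whose
current images touch, the joined domain inside their union.  No readiness, no pendency, no sizes `R`. [folklore] -/
def RealisesZ (L : ℕ) (s : ℕ → ℕ) : PGen (Pt d × Finset (Pt d)) → Finset (Pt d) → Prop
  | .birth _ cls zZ, Z => zZ.2 = Z ∧ zZ.1 ∈ Z ∧ FaceConnected Z ∧ treeLen Z ≤ cls
  | .renew G h, Z => ∃ ZG, RealisesZ L s G ZG ∧ G.lastStep < h ∧ Z = orbit L s G.lastStep ZG (h + 1 - G.lastStep)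
  | .join X Y sj, Z => ∃ ZX ZY, RealisesZ L s X ZX ∧ RealisesZ L s Y ZY ∧ X.lastStep ≤ sj ∧ Y.lastStep ≤ sj ∧
      (∃ a ∈ orbit L s X.lastStep ZX (sj - X.lastStep), ∃ c ∈ orbit L s Y.lastStep ZY (sj - Y.lastStep), Touch a c) ∧
      Z ⊆ orbit L s X.lastStep ZX (sj - X.lastStep) ∪ orbit L s Y.lastStep ZY (sj - Y.lastStep)

/-- **BRIDGE 1: row S1b's realisation has the zone skeleton** (readiness ⇒ an earlier last step, via `Stops.pos`;
pendency dropped). [folklore] -/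
theorem realisesZ_of_realises {L : ℕ} {s R : ℕ → ℕ} :
    ∀ (P : PGen (Pt d × Finset (Pt d))) (Z : Finset (Pt d)), Realises L s R P Z → RealisesZ L s P Z
  | .birth _ _ _, _, h => h
  | .renew G h, Z, hP => by
      obtain ⟨ZG, hG, hst, -, hZ⟩ := hP
      have := hst.pos
      exact ⟨ZG, realisesZ_of_realises G ZG hG, by omega, hZ⟩
  | .join X Y sj, Z, hP => by
      obtain ⟨ZX, ZY, hX, hY, htX, htY, -, -, hac, hZ⟩ := hP
      exact ⟨ZX, ZY, realisesZ_of_realises X ZX hX, realisesZ_of_realises Y ZY hY, htX, htY, hac, hZ⟩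

/-- **BRIDGE 2: the owner's PRINT-EXACT realisation has the zone skeleton** (same proof; `PendingBefore` dropped).
[folklore] -/
theorem realisesZ_of_realisesP {L : ℕ} {s R : ℕ → ℕ} :
    ∀ (P : PGen (Pt d × Finset (Pt d))) (Z : Finset (Pt d)), RealisesP L s R P Z → RealisesZ L s P Z
  | .birth _ _ _, _, h => h
  | .renew G h, Z, hP => by
      obtain ⟨ZG, hG, hst, -, hZ⟩ := hP
      have := hst.pos
      exact ⟨ZG, realisesZ_of_realisesP G ZG hG, by omega, hZ⟩
  | .join X Y sj, Z, hP => by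
      obtain ⟨ZX, ZY, hX, hY, htX, htY, -, -, hac, hZ⟩ := hP
      exact ⟨ZX, ZY, realisesZ_of_realisesP X ZX hX, realisesZ_of_realisesP Y ZY hY, htX, htY, hac, hZ⟩

/-- in a zone-skeleton realisation every sub-history's root step is at most its last step [folklore] -/
theorem lastStep_realisesZ_le {L : ℕ} {s : ℕ → ℕ} :
    ∀ (P : PGen (Pt d × Finset (Pt d))) (Z : Finset (Pt d)), RealisesZ L s P Z → P.rootStep ≤ P.lastStep
  | .birth j cls zZ, Z, _ => le_rfl
  | .renew G h, Z, hR => by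
      obtain ⟨ZG, hG, hlt, -⟩ := hR
      have := lastStep_realisesZ_le G ZG hG
      simp only [PGen.rootStep, PGen.lastStep]
      omega
  | .join A B sj, Z, hR => by
      obtain ⟨ZA, ZB, hA, hB, htA, htB, -, -⟩ := hR
      have := lastStep_realisesZ_le A ZA hA
      have := lastStep_realisesZ_le B ZB hB
      simp only [PGen.rootStep, PGen.lastStep]
      omega

variable {ε : Type*} [DecidableEq ε] {sh : ε → PEv} {pay : ε → Pt d × Finset (Pt d)}

/-! ## §1 Part II's walk over the zone skeleton -/

/-- **THE BIRTH FACTS READ OFF A ZONE-SKELETON CORRESPONDENCE**: every birth label of `G` has kind `0`, its anchor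
lies in its region, the region is face-connected and its tree length is at most the label's class. [folklore] -/
theorem births_facts_of_corrZ {L : ℕ} {s : ℕ → ℕ} :
    ∀ (P : PGen (Pt d × Finset (Pt d))) (G : Gen ε) (Z : Finset (Pt d)), Corr sh pay G P → RealisesZ L s P Z →
      ∀ b ∈ births G, (sh b).kind = 0 ∧ (pay b).1 ∈ (pay b).2 ∧ FaceConnected (pay b).2 ∧
        treeLen (pay b).2 ≤ (sh b).fat
  | .birth j cls zZ, Gen.born b' j', Z, hc, hR, b, hb => by
      obtain ⟨-, hsh, hpay⟩ := hc
      obtain ⟨hZ, hz, hfc, hlen⟩ := hR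
      rw [births_born, mem_singleton] at hb
      subst hb
      rw [hsh, hpay, hZ]
      exact ⟨rfl, hz, hfc, by simpa using hlen⟩
  | .birth _ _ _, Gen.renew _ _ _, _, hc, _, _, _ => hc.elim
  | .birth _ _ _, Gen.merge _ _ _, _, hc, _, _, _ => hc.elim
  | .renew P h, Gen.renew G e h', Z, hc, hR, b, hb => by
      obtain ⟨-, -, hc'⟩ := hc
      obtain ⟨ZG, hG, -, -⟩ := hR
      exact births_facts_of_corrZ P G ZG hc' hG b (by simpa using hb)
  | .renew _ _, Gen.born _ _, _, hc, _, _, _ => hc.elim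
  | .renew _ _, Gen.merge _ _ _, _, hc, _, _, _ => hc.elim
  | .join A B sj, Gen.merge X Y e, Z, hc, hR, b, hb => by
      obtain ⟨-, hcX, hcY⟩ := hc
      obtain ⟨ZA, ZB, hA, hB, -, -, -, -⟩ := hR
      rw [births_merge, mem_union] at hb
      rcases hb with hb | hb
      · exact births_facts_of_corrZ A X ZA hcX hA b hb
      · exact births_facts_of_corrZ B Y ZB hcY hB b hb
  | .join _ _ _, Gen.born _ _, _, hc, _, _, _ => hc.elim
  | .join _ _ _, Gen.renew _ _ _, _, hc, _, _, _ => hc.elim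

/-- **EVENT STEPS ARE AT MOST THE LAST STEP** of a zone-skeleton corresponding history. [folklore] -/
theorem events_step_le_of_corrZ {L : ℕ} {s : ℕ → ℕ} :
    ∀ (P : PGen (Pt d × Finset (Pt d))) (G : Gen ε) (Z : Finset (Pt d)), Corr sh pay G P → RealisesZ L s P Z →
      ∀ e ∈ G.events, (sh e).step ≤ P.lastStep
  | .birth j cls zZ, Gen.born b' j', Z, hc, _, e, he => by
      obtain ⟨hjj, hsh, -⟩ := hc
      rw [Gen.events_born, mem_singleton] at he
      subst he
      simp [hsh, PGen.lastStep]
  | .birth _ _ _, Gen.renew _ _ _, _, hc, _, _, _ => hc.elim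
  | .birth _ _ _, Gen.merge _ _ _, _, hc, _, _, _ => hc.elim
  | .renew P h, Gen.renew G e h', Z, hc, hR, x, hx => by
      obtain ⟨-, hsh, hc'⟩ := hc
      obtain ⟨ZG, hG, hlt, -⟩ := hR
      rw [Gen.events_renew, mem_insert] at hx
      rcases hx with rfl | hx
      · simp [hsh, PGen.lastStep]
      · have := events_step_le_of_corrZ P G ZG hc' hG x hx
        simp only [PGen.lastStep]
        omega
  | .renew _ _, Gen.born _ _, _, hc, _, _, _ => hc.elim
  | .renew _ _, Gen.merge _ _ _, _, hc, _, _, _ => hc.elim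
  | .join A B sj, Gen.merge X Y e, Z, hc, hR, x, hx => by
      obtain ⟨hsh, hcX, hcY⟩ := hc
      obtain ⟨ZA, ZB, hA, hB, htA, htB, -, -⟩ := hR
      rw [Gen.events_merge, mem_insert, mem_union] at hx
      rcases hx with rfl | hx | hx
      · simp [hsh, PGen.lastStep]
      · exact (events_step_le_of_corrZ A X ZA hcX hA x hx).trans htA
      · exact (events_step_le_of_corrZ B Y ZB hcY hB x hx).trans htB
  | .join _ _ _, Gen.born _ _, _, hc, _, _, _ => hc.elim
  | .join _ _ _, Gen.renew _ _ _, _, hc, _, _, _ => hc.elim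

/-! ## §2 The walk: reduced orbits in levelled zones, contact, the birth-region laws -/

section Walk

variable {L : ℕ} (hL : 3 ≤ L) {n : ℕ} (hn : 0 < n) {s : ℕ → ℕ} (hs : ∀ t, s (t + 1) ≤ s t)
  (hdrop : ∀ m, DropCtl s m) {R : ℕ → ℕ} {K : ℕ}
include hL hn hs hdrop

/-- **THE REDUCED ORBIT OF A ZONE-SKELETON SUB-HISTORY LIES IN ITS LEVELLED `31`-ZONE.**  For `Corr G P`,
`RealisesZ L s P Z` and `P.lastStep ≤ t ≤ K` (with `lv := levelOf s K`):
`redZone (n·L^{K − lv t}) (orbit L s P.lastStep Z (t − P.lastStep)) ⊆ regZoneD sh n L K lv 31 regR t G`. [folklore] -/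
theorem redZone_orbit_subset_regZoneDZ :
    ∀ (P : PGen (Pt d × Finset (Pt d))) (G : Gen ε) (Z : Finset (Pt d)) (t : ℕ), Corr sh pay G P →
      RealisesZ L s P Z → P.lastStep ≤ t → t ≤ K →
      redZone (n * L ^ (K - levelOf s K t)) (orbit L s P.lastStep Z (t - P.lastStep)) ⊆
        regZoneD sh n L K (levelOf s K) 31 (regR sh pay n L K (levelOf s K)) t G
  | .birth j cls zZ, Gen.born b' j', Z, t, hc, hR, hjt, htK => by
      obtain ⟨hjj, hsh, hpay⟩ := hc
      obtain ⟨hZ, -, -, -⟩ := hR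
      have hstep : (sh b').step = j := by rw [hsh]; rfl
      simp only [PGen.lastStep] at hjt ⊢
      rw [regZoneD_born n L K (levelOf s K) 31 _ j' (by rw [hstep]; exact hjt), hstep]
      have hreg : regR sh pay n L K (levelOf s K) b' = redZone (n * L ^ (K - levelOf s K j)) Z := by
        rw [regR, hpay, hZ, hstep]
      rw [hreg]
      exact redZone_orbit_subset hL hn hs hdrop hjt htK Z
  | .birth _ _ _, Gen.renew _ _ _, _, _, hc, _, _, _ => hc.elim
  | .birth _ _ _, Gen.merge _ _ _, _, _, hc, _, _, _ => hc.elim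
  | .renew P h, Gen.renew G e h', Z, t, hc, hR, hht, htK => by
      obtain ⟨-, -, hc'⟩ := hc
      obtain ⟨ZG, hG, hlt, hZ⟩ := hR
      simp only [PGen.lastStep] at hht ⊢
      have horb : orbit L s (h + 1) Z (t - (h + 1)) = orbit L s P.lastStep ZG (t - P.lastStep) := by
        have e := orbit_add L s P.lastStep ZG (h + 1 - P.lastStep) (t - (h + 1))
        rw [show P.lastStep + (h + 1 - P.lastStep) = h + 1 by omega,
          show h + 1 - P.lastStep + (t - (h + 1)) = t - P.lastStep by omega] at e
        rw [hZ]
        exact e.symm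
      rw [horb, regZoneD_renew]
      exact redZone_orbit_subset_regZoneDZ P G ZG t hc' hG (by omega) htK
  | .renew _ _, Gen.born _ _, _, _, hc, _, _, _ => hc.elim
  | .renew _ _, Gen.merge _ _ _, _, _, hc, _, _, _ => hc.elim
  | .join A B sj, Gen.merge X Y e, Z, t, hc, hR, hst, htK => by
      obtain ⟨-, hcX, hcY⟩ := hc
      obtain ⟨ZA, ZB, hA, hB, htA, htB, -, hZ⟩ := hR
      simp only [PGen.lastStep] at hst ⊢
      have hA' : orbit L s sj (orbit L s A.lastStep ZA (sj - A.lastStep)) (t - sj) =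
          orbit L s A.lastStep ZA (t - A.lastStep) := by
        have e := orbit_add L s A.lastStep ZA (sj - A.lastStep) (t - sj)
        rw [show A.lastStep + (sj - A.lastStep) = sj by omega,
          show sj - A.lastStep + (t - sj) = t - A.lastStep by omega] at e
        exact e.symm
      have hB' : orbit L s sj (orbit L s B.lastStep ZB (sj - B.lastStep)) (t - sj) =
          orbit L s B.lastStep ZB (t - B.lastStep) := by
        have e := orbit_add L s B.lastStep ZB (sj - B.lastStep) (t - sj)
        rw [show B.lastStep + (sj - B.lastStep) = sj by omega,
          show sj - B.lastStep + (t - sj) = t - B.lastStep by omega] at e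
        exact e.symm
      have hunion : ∀ (X₁ X₂ : Finset (Pt d)) (l : ℕ),
          orbit L s sj (X₁ ∪ X₂) l = orbit L s sj X₁ l ∪ orbit L s sj X₂ l := fun X₁ X₂ l => Siter_union _ _ _ _
      have hsub : orbit L s sj Z (t - sj) ⊆
          orbit L s A.lastStep ZA (t - A.lastStep) ∪ orbit L s B.lastStep ZB (t - B.lastStep) := by
        have h1 : orbit L s sj Z (t - sj) ⊆
            orbit L s sj (orbit L s A.lastStep ZA (sj - A.lastStep) ∪ orbit L s B.lastStep ZB (sj - B.lastStep))
              (t - sj) := SpaceTimePeierls.Siter_mono _ hZ _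
        rw [hunion, hA', hB'] at h1
        exact h1
      intro u hu
      have hu' := redZone_mono _ hsub hu
      rw [redZone_union, mem_union] at hu'
      rw [regZoneD_merge, mem_union]
      rcases hu' with hu' | hu'
      · exact Or.inl (redZone_orbit_subset_regZoneDZ A X ZA t hcX hA (htA.trans hst) htK hu')
      · exact Or.inr (redZone_orbit_subset_regZoneDZ B Y ZB t hcY hB (htB.trans hst) htK hu')
  | .join _ _ _, Gen.born _ _, _, _, hc, _, _, _ => hc.elim
  | .join _ _ _, Gen.renew _ _ _, _, _, hc, _, _, _ => hc.elim

/-- **CONTACT AT EVERY MERGE NODE OF A ZONE-SKELETON CORRESPONDING HISTORY**: the partners' levelled `32`-zones share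
a cell at the merger's shape-step (the reduced touching cube of the older partner's S-image). [folklore] -/
theorem contact_of_corrZ :
    ∀ (P : PGen (Pt d × Finset (Pt d))) (G : Gen ε) (Z : Finset (Pt d)), Corr sh pay G P → RealisesZ L s P Z →
      P.lastStep ≤ K → ∀ (X Y : Gen ε) (e : ε), Sub (Gen.merge X Y e) G →
        ∃ z, z ∈ regZoneD sh n L K (levelOf s K) 32 (regR sh pay n L K (levelOf s K)) (sh e).step X ∧
          z ∈ regZoneD sh n L K (levelOf s K) 32 (regR sh pay n L K (levelOf s K)) (sh e).step Y
  | .birth j cls zZ, Gen.born b' j', Z, _, _, _, X, Y, e, hsub => by cases hsub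
  | .birth _ _ _, Gen.renew _ _ _, _, hc, _, _, _, _, _, _ => hc.elim
  | .birth _ _ _, Gen.merge _ _ _, _, hc, _, _, _, _, _, _ => hc.elim
  | .renew P h, Gen.renew G e' h', Z, hc, hR, hK, X, Y, e, hsub => by
      obtain ⟨-, -, hc'⟩ := hc
      obtain ⟨ZG, hG, hlt, -⟩ := hR
      simp only [PGen.lastStep] at hK
      cases hsub with
      | renew _ _ hs' => exact contact_of_corrZ P G ZG hc' hG (by omega) X Y e hs'
  | .renew _ _, Gen.born _ _, _, hc, _, _, _, _, _, _ => hc.elim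
  | .renew _ _, Gen.merge _ _ _, _, hc, _, _, _, _, _, _ => hc.elim
  | .join A B sj, Gen.merge X' Y' e', Z, hc, hR, hK, X, Y, e, hsub => by
      obtain ⟨hsh, hcX, hcY⟩ := hc
      obtain ⟨ZA, ZB, hA, hB, htA, htB, ⟨a, ha, c, hcm, hac⟩, -⟩ := hR
      simp only [PGen.lastStep] at hK
      cases hsub with
      | refl =>
          -- the node itself: the reduced touching cube `a` of the older partner's S-image
          have hL0 : 0 < L := by omega
          have hsK : ∀ u, u < K → s (u + 1) ≤ s u := fun u _ => hs u
          have hLF := levelFn_levelOf hsK (hdrop K)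
          have hstep : (sh e').step = sj := by rw [hsh]; rfl
          set m := n * L ^ (K - levelOf s K sj) with hm
          have hm0 : 0 < m := Nat.mul_pos hn (pow_pos hL0 _)
          set u : Fin d → ℕ := fun i => res m (a i) with hu
          set w : Fin d → ℕ := fun i => res m (c i) with hw
          have hua : u ∈ redZone m (orbit L s A.lastStep ZA (sj - A.lastStep)) := mem_image.2 ⟨a, ha, rfl⟩
          have hwc : w ∈ redZone m (orbit L s B.lastStep ZB (sj - B.lastStep)) := mem_image.2 ⟨c, hcm, rfl⟩
          have hA31 := redZone_orbit_subset_regZoneDZ hL hn hs hdrop A X' ZA sj hcX hA htA hK hua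
          have hB31 := redZone_orbit_subset_regZoneDZ hL hn hs hdrop B Y' ZB sj hcY hB htB hK hwc
          have huw : cdist m u w ≤ 1 := cdist_red_le hm0 a c 1 fun i => by
            obtain ⟨h1, h2⟩ := hac i
            omega
          refine ⟨u, ?_, ?_⟩
          · rw [hstep]
            exact HistoryZoneMass.thickT_mono_radius m (by norm_num) _ hA31
          · rw [hstep]
            exact mem_thickT_succ_of_cdist_le_one (inRange_coreZoneD_regR hn hL0 hLF sj Y')
              (fun i => res_lt hm0 (a i)) hB31 huw
      | left _ _ hs' => exact contact_of_corrZ A X' ZA hcX hA (htA.trans hK) X Y e hs'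
      | right _ _ hs' => exact contact_of_corrZ B Y' ZB hcY hB (htB.trans hK) X Y e hs'
  | .join _ _ _, Gen.born _ _, _, hc, _, _, _, _, _, _ => hc.elim
  | .join _ _ _, Gen.renew _ _ _, _, hc, _, _, _, _, _, _ => hc.elim

/-- **A ZONE-SKELETON CORRESPONDING HISTORY INHABITS THE LEVELLED BIRTH-REGION LAWS** (`Cb = 4·2^d`, collar `32`,
`lv := levelOf s K`). [folklore] -/
theorem birthRegionsD_of_corrZ {P : PGen (Pt d × Finset (Pt d))} {G : Gen ε} {Z : Finset (Pt d)}
    (hc : Corr sh pay G P) (hR : RealisesZ L s P Z) (hK : P.lastStep ≤ K) :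
    BirthRegionsD sh n L K (levelOf s K) (4 * 2 ^ d) 32 G (regR sh pay n L K (levelOf s K)) :=
  birthRegionsD_of_faceConnected sh (Nat.one_le_iff_ne_zero.2 (Nat.pos_iff_ne_zero.1 hn)) (by omega) (levelOf s K) 32
    (fun b => (pay b).2) (fun b hb => ⟨_, (births_facts_of_corrZ P G Z hc hR b hb).2.1⟩)
    (fun b hb => (births_facts_of_corrZ P G Z hc hR b hb).2.2.1)
    (fun b hb => (births_facts_of_corrZ P G Z hc hR b hb).2.2.2)
    (fun b hb => (births_facts_of_corrZ P G Z hc hR b hb).1)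
    (contact_of_corrZ hL hn hs hdrop P G Z hc hR hK)

end Walk

/-! ## §3 Sanity -/

namespace SanityZOR5

/-- row S1b's unit region (leaf-08's decided sanity datum) has the zone skeleton, through either bridge [folklore] -/
example (L : ℕ) (s R : ℕ → ℕ) : RealisesZ L s HistoryRealise.Sanity.unit {B16MergeGeometry.OneDim.pt 0} :=
  realisesZ_of_realisesP _ _ (HistoryRealisePrint.Sanity.realisesP_unit L s R)

/-- A CLOCK-FREE REALISED JOIN: two regions born at step `0` and joined AT step `0` on their common cell have the zone
skeleton for EVERY flow `L, s` — no stopping rule, no sizes, no pendency is asked (whereas `Realises`∕`RealisesP`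
quantify over the sizes `R`). [folklore] -/
example (L : ℕ) (s : ℕ → ℕ) (a : Pt d) (c₁ c₂ : ℕ) :
    RealisesZ L s (PGen.join (PGen.birth 0 c₁ (a, {a})) (PGen.birth 0 c₂ (a, {a})) 0) {a} := by
  have hfc : FaceConnected ({a} : Finset (Pt d)) := fun x hx y hy => by
    rw [mem_singleton] at hx hy; subst hx; subst hy; exact Relation.ReflTransGen.refl
  have hlen : ∀ c : ℕ, treeLen ({a} : Finset (Pt d)) ≤ c := fun c => by rw [treeLen_singleton]; exact Nat.cast_nonneg c
  refine ⟨{a}, {a}, ⟨rfl, mem_singleton_self a, hfc, hlen c₁⟩, ⟨rfl, mem_singleton_self a, hfc, hlen c₂⟩, le_rfl,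
    le_rfl, ⟨a, ?_, a, ?_, fun μ => ⟨by omega, by omega⟩⟩, ?_⟩
  · simp [PGen.lastStep]
  · simp [PGen.lastStep]
  · simp [PGen.lastStep]

end SanityZOR5

end

end Summit.QuantumFields.BalabanUV.T4Continuum.HistoryZones
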